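import Mathlib.Order.PiLex
import Mathlib.Order.UpperLower.Basic
import Mathlib.Data.Fintype.Lattice
import Mathlib.Data.Finite.Prod
import Mathlib.Algebra.Group.Subgroup.Defs
import Mathlib.GroupTheory.Perm.Basic
import HarnessLib

/-!
# Lex-leader symmetry breaking is sound — the coverage theorem behind the W5 pinned-cube verdicts

Cell `pub-hsemireg`, widening group W5, seat w5-n7-1 (gen 11); files of record
`widen/W5/N7-FEASIBILITY-w5n7.md` (N7F) §3.16 (b)(c) and the referee memo `widen/W5/EXTSYM-SOUNDNESS-w5n7g6.md`
(§1 FACT, §2 LEMMA 1 + COROLLARY, §3 COVERAGE THEOREM + COROLLARY; REF-W row 220 re-derived them by hand).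
HONEST FRAMING: pure finite order theory of assignments `X : ι → α` on a linearly ordered index set `ι`
(the SAT variables in one fixed total order, first variable most significant) compared in the
lexicographic order `Pi.Lex`, and of permutations `σ` of `ι` acting by relabelling, `X ↦ X ∘ σ`.
A LEX-LEADER CONSTRAINT of `σ` is `toLex (X ∘ σ) ≤ toLex X` («`X ≥_lex σ·X`»). What is kernel-checked:

* `exists_lexMax`, `exists_model_forall_lexLeader` — §1 FACT (Crawford–Ginsberg–Luks–Roy, KR 1996): if a
  constraint `P` is preserved by every permutation of a set `S`, then `P` is satisfiable iff `P` together with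
  ALL lex-leader constraints of `S` is satisfiable (the lex-maximal model satisfies them). No group structure
  on `S` is needed; `forall_lexLeader_inv_iff` records that over a subgroup the two conventions
  `(g·X)_k = X_{g⁻¹ k}` and `(g·X)_k = X_{g k}` give the same family of constraints.
* `toLex_comp_lt_iff`, `lexLeader_iff_restrict` — §2 LEMMA 1 in abstract form: for an INVOLUTION `σ` the
  lex-leader constraint of `σ` on all variables is equivalent to the lexicographic comparison
  `(X (σ t))_t ≤_lex (X t)_t` over the «upper» moved positions `t < σ t` alone, in their order (for a
  transposition of two equal-margin levels `b₁ < b₂` these are the level-`b₁` variables and `σ` of them the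
  level-`b₂` variables: the chains `V(b₂) ≤_lex V(b₁)` of the memo); `lexLeader_iff_first_upper_diff` is the
  «first differing position decides» reading used in the memo's proof.
* `toLex_restrict_le_of_isLowerSet`, `restrict_le_of_lexLeader` — §2 COROLLARY: comparing only an initial
  segment of the chains is a RELAXATION of the full constraint (csknsat's own row/column constraints are the
  first segments of the EXTSYM chains).
* `coverage`, `eq_empty_of_forall_unsat` — §3 COVERAGE THEOREM and its COROLLARY («per-orbit closure keeps its
  meaning») with the MODEL FACTS AS HYPOTHESES: the invariance of the design set under the group `Γ_O`
  (memo §3 (i)), the inclusions `Γ_L, Stab(v) ⊆ Γ_O`, and the listing criterion (memo §3 (iii): a design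
  satisfying the base lex constraints has a LISTED core). Conclusion: some listed variant's full instance
  (design ∧ base ∧ ext ∧ units ∧ stab) is satisfiable; contrapositive: if every listed variant has SOME
  sub-instance UNSAT, no design has its core in the orbit.

NOT formalised: the CNF `B₀`, the group `Γ = S_n ⋉ ∏ Sym(levels)`, the fact that the class equations are
`Γ`-invariant, mkcubes' listing, any solver output. Nothing here is a statement about a variety, a sheaf
or a Hodge class, and nothing here bears on HC / HC_CM / HC_AV.
-/

namespace Summit.Ventures.HSemireg.LexLeaderCoverage

variable {ι : Type*} [LinearOrder ι] {α : Type*}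

/-! ### The lexicographic order on assignments -/

section LexOrder

variable [LinearOrder α]

/-- Unfolding of the strict lexicographic order on assignments: `x <_lex y` iff at the first position where
they differ, `x` is smaller. (First variable most significant.) -/
theorem toLex_lt_toLex_iff (x y : ι → α) :
    toLex x < toLex y ↔ ∃ i, (∀ j < i, x j = y j) ∧ x i < y i :=
  Iff.rfl

/-- Among the models of a satisfiable constraint on finitely many ordered variables with finitely many
values there is a lexicographically MAXIMAL one. -/
theorem exists_lexMax [Finite ι] [Finite α] (P : (ι → α) → Prop) (h : ∃ X, P X) :
    ∃ X, P X ∧ ∀ Y, P Y → toLex Y ≤ toLex X := by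
  obtain ⟨X₀, hX₀⟩ := h
  haveI : Nonempty {X // P X} := ⟨⟨X₀, hX₀⟩⟩
  obtain ⟨⟨X, hX⟩, hmax⟩ := Finite.exists_max fun X : {X // P X} => toLex X.1
  exact ⟨X, hX, fun Y hY => hmax ⟨Y, hY⟩⟩

/-- **§1 FACT (lex-leader predicates are sound; Crawford–Ginsberg–Luks–Roy 1996).** If the constraint `P`
is preserved by every permutation `g` of a set `S` (acting by relabelling `X ↦ X ∘ g`), and `P` is
satisfiable, then `P` has a model satisfying the lex-leader constraint `toLex (X ∘ g) ≤ toLex X` of EVERY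
`g ∈ S` simultaneously — namely a lex-maximal model. No group structure on `S` is used. -/
theorem exists_model_forall_lexLeader [Finite ι] [Finite α] (P : (ι → α) → Prop)
    (S : Set (Equiv.Perm ι)) (hP : ∀ g ∈ S, ∀ X, P X → P (X ∘ ⇑g)) (h : ∃ X, P X) :
    ∃ X, P X ∧ ∀ g ∈ S, toLex (X ∘ ⇑g) ≤ toLex X := by
  obtain ⟨X, hX, hmax⟩ := exists_lexMax P h
  exact ⟨X, hX, fun g hg => hmax _ (hP g hg X hX)⟩

/-- Over a SUBGROUP `Γ` the two conventions for «the lex-leader constraints of `Γ`» — relabelling by `g⁻¹`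
(`(g·X)_k = X_{g⁻¹ k}`, the memo's `LL(g)`) or by `g` (`(ρ_g X)_k = X_{g k}`, the memo's STABSYM form) —
give the same family of constraints. -/
theorem forall_lexLeader_inv_iff (Γ : Subgroup (Equiv.Perm ι)) (X : ι → α) :
    (∀ g ∈ Γ, toLex (X ∘ ⇑g⁻¹) ≤ toLex X) ↔ ∀ g ∈ Γ, toLex (X ∘ ⇑g) ≤ toLex X :=
  ⟨fun h g hg => by simpa only [inv_inv] using h g⁻¹ (Γ.inv_mem hg),
    fun h g hg => h g⁻¹ (Γ.inv_mem hg)⟩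

end LexOrder

/-! ### §2 LEMMA 1 — the lex-leader constraint of an involution lives on the upper moved positions -/

/-- For an involution `σ`: if `X ∘ σ` and `X` agree at every UPPER moved position (`j < σ j`) below `i`,
they agree at every position below `i` (a lower moved position `σ j < j < i` is the image of the upper
moved position `σ j < i`). -/
theorem eq_below_of_eq_below_upper {σ : Equiv.Perm ι} (hσ : ∀ k, σ (σ k) = k) {X : ι → α} {i : ι}
    (h : ∀ j < i, j < σ j → X (σ j) = X j) : ∀ j < i, X (σ j) = X j := by
  intro j hj
  rcases lt_trichotomy j (σ j) with hlt | heq | hgt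
  · exact h j hj hlt
  · rw [← heq]
  · have h' := h (σ j) (hgt.trans hj) (by rwa [hσ])
    rw [hσ] at h'
    exact h'.symm

/-- For an involution `σ`: if `X ∘ σ` and `X` agree at every upper moved position, then `X ∘ σ = X`. -/
theorem comp_eq_self_of_eq_upper {σ : Equiv.Perm ι} (hσ : ∀ k, σ (σ k) = k) {X : ι → α}
    (h : ∀ j, j < σ j → X (σ j) = X j) : X ∘ ⇑σ = X := by
  funext j
  rw [Function.comp_apply]
  rcases lt_trichotomy j (σ j) with hlt | heq | hgt
  · exact h j hlt
  · rw [← heq]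
  · have h' := h (σ j) (by rwa [hσ])
    rw [hσ] at h'
    exact h'.symm

/-- For an involution `σ`: the first position at which `X ∘ σ` and `X` differ is an UPPER moved position. -/
theorem lt_apply_of_first_diff {σ : Equiv.Perm ι} (hσ : ∀ k, σ (σ k) = k) {X : ι → α} {i : ι}
    (hlt : ∀ j < i, X (σ j) = X j) (hne : X (σ i) ≠ X i) : i < σ i := by
  rcases lt_trichotomy i (σ i) with h | h | h
  · exact h
  · exact absurd (show X (σ i) = X i by rw [← h]) hne
  · have h' := hlt (σ i) h
    rw [hσ] at h'
    exact absurd h'.symm hne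

section Involution

variable [LinearOrder α]

/-- **§2 LEMMA 1, strict form.** For an involution `σ`, `X ∘ σ <_lex X` iff there is an UPPER moved position
`i < σ i` such that `X ∘ σ` and `X` agree at all upper moved positions before `i` and `X (σ i) < X i`. -/
theorem toLex_comp_lt_iff {σ : Equiv.Perm ι} (hσ : ∀ k, σ (σ k) = k) (X : ι → α) :
    toLex (X ∘ ⇑σ) < toLex X ↔
      ∃ i, i < σ i ∧ (∀ j < i, j < σ j → X (σ j) = X j) ∧ X (σ i) < X i := by
  rw [toLex_lt_toLex_iff]
  constructor
  · rintro ⟨i, hlt, hi⟩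
    have hlt' : ∀ j < i, X (σ j) = X j := fun j hj => hlt j hj
    exact ⟨i, lt_apply_of_first_diff hσ hlt' (ne_of_lt hi), fun j hj _ => hlt' j hj, hi⟩
  · rintro ⟨i, -, hlt, hi⟩
    exact ⟨i, eq_below_of_eq_below_upper hσ hlt, hi⟩

/-- **§2 LEMMA 1.** For an involution `σ`, the lex-leader constraint `toLex (X ∘ σ) ≤ toLex X` on ALL
variables is equivalent to the lexicographic comparison, over the upper moved positions `t < σ t` alone and
in their order, of the chain `(X (σ t))_t` against the chain `(X t)_t`. For the transposition of two
equal-margin levels `b₁ < b₂` of one coordinate this is the memo's `V(b₂) ≤_lex V(b₁)`. -/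
theorem lexLeader_iff_restrict {σ : Equiv.Perm ι} (hσ : ∀ k, σ (σ k) = k) (X : ι → α) :
    toLex (X ∘ ⇑σ) ≤ toLex X ↔
      toLex (fun t : {k // k < σ k} => X (σ t)) ≤ toLex (fun t : {k // k < σ k} => X t) := by
  rw [le_iff_lt_or_eq, le_iff_lt_or_eq, toLex_comp_lt_iff hσ, toLex_lt_toLex_iff, toLex_inj, toLex_inj]
  apply or_congr
  · constructor
    · rintro ⟨i, hi, hlt, hX⟩
      exact ⟨⟨i, hi⟩, fun t ht => hlt t.1 ht t.2, hX⟩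
    · rintro ⟨⟨i, hi⟩, hlt, hX⟩
      exact ⟨i, hi, fun j hj hj' => hlt ⟨j, hj'⟩ hj, hX⟩
  · constructor
    · intro h
      funext t
      exact congrFun h t.1
    · intro h
      exact comp_eq_self_of_eq_upper hσ fun j hj => congrFun h ⟨j, hj⟩

/-- **§2 LEMMA 1, «first difference decides» reading** (the form used in the memo's proof: «LL demands
`X(a*, b₁) = 1` at the first differing row»). For an involution `σ` on a well-ordered index set, the
lex-leader constraint of `σ` holds iff at the FIRST upper moved position where `X ∘ σ` and `X` differ (if
any), `X (σ i) < X i`. -/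
theorem lexLeader_iff_first_upper_diff [WellFoundedLT ι] {σ : Equiv.Perm ι} (hσ : ∀ k, σ (σ k) = k)
    (X : ι → α) :
    toLex (X ∘ ⇑σ) ≤ toLex X ↔
      ∀ i, i < σ i → (∀ j < i, j < σ j → X (σ j) = X j) → X (σ i) ≠ X i → X (σ i) < X i := by
  rw [le_iff_lt_or_eq, toLex_comp_lt_iff hσ, toLex_inj]
  constructor
  · rintro (⟨i, hi, hlt, hX⟩ | heq) i' hi' hlt' hne'
    · rcases lt_trichotomy i' i with h | rfl | h
      · exact absurd (eq_below_of_eq_below_upper hσ hlt i' h) hne'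
      · exact hX
      · exact absurd (hlt' i h hi) (ne_of_lt hX)
    · exact absurd (congrFun heq i') hne'
  · intro h
    by_cases hall : ∀ j, j < σ j → X (σ j) = X j
    · exact Or.inr (comp_eq_self_of_eq_upper hσ hall)
    · push Not at hall
      obtain ⟨i, hi, hlt⟩ := WellFounded.has_min wellFounded_lt {j | j < σ j ∧ X (σ j) ≠ X j} hall
      refine Or.inl ⟨i, hi.1, fun j hj hj' => ?_, h i hi.1 (fun j hj hj' => ?_) hi.2⟩ <;>
        exact not_not.1 fun hne => hlt j ⟨hj', hne⟩ hj

/-- In the BOOLEAN case the deciding inequality `X (σ i) < X i` reads `X i = true` (and `X (σ i) = false`). -/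
theorem lexLeader_iff_first_upper_diff_bool [WellFoundedLT ι] {σ : Equiv.Perm ι} (hσ : ∀ k, σ (σ k) = k)
    (X : ι → Bool) :
    toLex (X ∘ ⇑σ) ≤ toLex X ↔
      ∀ i, i < σ i → (∀ j < i, j < σ j → X (σ j) = X j) → X (σ i) ≠ X i → X i = true := by
  rw [lexLeader_iff_first_upper_diff hσ]
  refine forall₄_congr fun i _ _ hne => ?_
  rcases hXi : X i <;> rcases hXσ : X (σ i) <;> simp_all

/-! ### §2 COROLLARY — first segments are relaxations -/

/-- Restricting both sides of a lexicographic inequality to an INITIAL SEGMENT (a lower set of positions)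
preserves it: comparing only a first segment of the chains is a relaxation of the full comparison. -/
theorem toLex_restrict_le_of_isLowerSet {I : Set ι} (hI : IsLowerSet I) {x y : ι → α}
    (h : toLex x ≤ toLex y) : toLex (fun i : I => x i) ≤ toLex (fun i : I => y i) := by
  rcases h.lt_or_eq with hlt | heq
  · obtain ⟨i, hi, hxy⟩ := (toLex_lt_toLex_iff x y).1 hlt
    by_cases hiI : i ∈ I
    · exact le_of_lt ((toLex_lt_toLex_iff _ _).2 ⟨⟨i, hiI⟩, fun j hj => hi j.1 hj, hxy⟩)
    · have hxyI : (fun j : I => x j) = fun j : I => y j :=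
        funext fun j => hi j.1 (lt_of_not_ge fun hij => hiI (hI hij j.2))
      rw [hxyI]
  · rw [toLex_inj] at heq
    rw [heq]

/-- **§2 COROLLARY (csknsat's own constraints are relaxations of the EXTSYM chains).** For an involution `σ`,
the full lex-leader constraint of `σ` implies the comparison of any INITIAL SEGMENT `I` of the two chains
over the upper moved positions. -/
theorem restrict_le_of_lexLeader {σ : Equiv.Perm ι} (hσ : ∀ k, σ (σ k) = k) (X : ι → α)
    (h : toLex (X ∘ ⇑σ) ≤ toLex X) {I : Set {k // k < σ k}} (hI : IsLowerSet I) :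
    toLex (fun t : I => X (σ t.1.1)) ≤ toLex (fun t : I => X t.1.1) :=
  toLex_restrict_le_of_isLowerSet hI ((lexLeader_iff_restrict hσ X).1 h)

/-! ### §3 The coverage theorem -/

/-- **§3 COVERAGE THEOREM** (memo §3, model facts as hypotheses). Data: `𝒟` = the designs whose heavy
core is a deuce-swap variant of the orbit representative `r` (nonempty by the hypothesis «some design has its
core in the orbit», after moving it by `π`); `Γ` = the group `Γ_O = ⟨Γ_L, Stab(r)⟩` as a SET of permutations of
the variables; `core X` = the pinned heavy core of `X`; `Gbase ⊆ Γ` = the adjacent equal-margin level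
transpositions (whose lex-leader constraints are EXTSYM's `L_ext`, with csknsat's `L_base` a relaxation);
`Stab v ⊆ Γ` = the stabiliser of the variant `v` (STABSYM's `L_stab(v)`); `L` = mkcubes' listed variants.
HYPOTHESES: (i) `Γ` maps `𝒟` to itself; the inclusions; (iii) a design satisfying the base lex
constraints has a listed core. CONCLUSION: there is a design `X ∈ 𝒟` whose core `v* = core X` is LISTED and
which satisfies every constraint of the instance `I(v*)` — the lex-leader constraints of all of `Gbase`
(hence `L_base ∧ L_ext`), `units(v*)` (tautologically: `v*` is its core) and those of `Stab v*`. PROOF =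
memo (ii): the lex-maximal element of `𝒟`. -/
theorem coverage [Finite ι] [Finite α] {V : Type*} (𝒟 : Set (ι → α)) (Γ Gbase : Set (Equiv.Perm ι))
    (Stab : V → Set (Equiv.Perm ι)) (core : (ι → α) → V) (L : Set V)
    (h𝒟 : ∀ g ∈ Γ, ∀ X ∈ 𝒟, X ∘ ⇑g ∈ 𝒟) (hGbase : Gbase ⊆ Γ) (hStab : ∀ X ∈ 𝒟, Stab (core X) ⊆ Γ)
    (hL : ∀ X ∈ 𝒟, (∀ g ∈ Gbase, toLex (X ∘ ⇑g) ≤ toLex X) → core X ∈ L) (hne : 𝒟.Nonempty) :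
    ∃ X ∈ 𝒟, core X ∈ L ∧ (∀ g ∈ Gbase, toLex (X ∘ ⇑g) ≤ toLex X) ∧
      ∀ g ∈ Stab (core X), toLex (X ∘ ⇑g) ≤ toLex X := by
  obtain ⟨X, hX, hmax⟩ := exists_model_forall_lexLeader (· ∈ 𝒟) Γ h𝒟 hne
  have hbase : ∀ g ∈ Gbase, toLex (X ∘ ⇑g) ≤ toLex X := fun g hg => hmax g (hGbase hg)
  exact ⟨X, hX, hL X hX hbase, hbase, fun g hg => hmax g (hStab X hX hg)⟩

/-- **§3 COROLLARY (per-orbit closure keeps its meaning; mixed regimes allowed).** Same data; in addition,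
for every listed variant `v` a SUB-INSTANCE `C v` of the full instance — any constraint implied, on designs
with core `v`, by the lex-leader constraints of `Gbase` and of `Stab v` (P1: base + units only; C1 / tail:
with `L_ext`, with or without `L_stab(v)`; dropping constraints only weakens). If every listed variant's
sub-instance is UNSAT among the designs, then NO design has its core in the orbit: `𝒟 = ∅`. -/
theorem eq_empty_of_forall_unsat [Finite ι] [Finite α] {V : Type*} (𝒟 : Set (ι → α))
    (Γ Gbase : Set (Equiv.Perm ι)) (Stab : V → Set (Equiv.Perm ι)) (core : (ι → α) → V) (L : Set V)
    (h𝒟 : ∀ g ∈ Γ, ∀ X ∈ 𝒟, X ∘ ⇑g ∈ 𝒟) (hGbase : Gbase ⊆ Γ) (hStab : ∀ X ∈ 𝒟, Stab (core X) ⊆ Γ)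
    (hL : ∀ X ∈ 𝒟, (∀ g ∈ Gbase, toLex (X ∘ ⇑g) ≤ toLex X) → core X ∈ L)
    (C : V → (ι → α) → Prop)
    (hC : ∀ X ∈ 𝒟, (∀ g ∈ Gbase, toLex (X ∘ ⇑g) ≤ toLex X) →
      (∀ g ∈ Stab (core X), toLex (X ∘ ⇑g) ≤ toLex X) → C (core X) X)
    (hUNSAT : ∀ v ∈ L, ¬ ∃ X ∈ 𝒟, core X = v ∧ C v X) : 𝒟 = ∅ := by
  rw [Set.eq_empty_iff_forall_notMem]
  intro X₀ hX₀
  obtain ⟨X, hX, hXL, hbase, hstab⟩ := coverage 𝒟 Γ Gbase Stab core L h𝒟 hGbase hStab hL ⟨X₀, hX₀⟩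
  exact hUNSAT (core X) hXL ⟨X, hX, rfl, hC X hX hbase hstab⟩

end Involution

end Summit.Ventures.HSemireg.LexLeaderCoverage
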